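import Literature.MathematicalPhysics.QuantumFieldTheory.PlaquetteFieldPolymerExpansion
import Literature.MathematicalPhysics.QuantumFieldTheory.PlaquetteFieldTwistLocality
import Literature.MathematicalPhysics.QuantumLattice.TwistedSectorClassicalRate
import Literature.Probability.LatticeModels.ClusterExpansionKPBound
import Literature.Probability.LatticeModels.AnchoredClusterExpansion
import HarnessLib

/-!
# The strong-coupling bound on EVERY 't Hooft twist sector: `1 - Z_z(β)/Z_1(β) ≤ 2d² L^{d-2} e^{-L²/2}` for all twists `z`
# (all planes at once), every compact gauge group — Ito–Seiler 2008 Thm 2.2 (1) ∕ Tomboulis 2007 §6.2 for general twist tensors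

Topic `Literature/MathematicalPhysics/QuantumFieldTheory`; vocabulary of `PlaquetteFieldPolymers.lean` (namespace `CentralTwist`: families
`w : Plaquette d L → G → ℝ`, `twistBy t w`, `twistInsertion z`, `wilsonFamily ρ β`, `fieldPolymerActivity`, `fieldZ`), of
`PlaquetteFieldPolymerExpansion.lean` (Kotecký–Preiss smallness for families), `PlaquetteFieldTwistLocality.lean` (twist locality for
every twist), `TwistedPartitionFunction.lean` (`insertedPartitionFunction ρ β L t`), `QuantumLattice/TwistedBoundaryConditions.lean`
(`Twist d G`, `twistedPartitionFunction ρ z β : ℝ≥0∞`, `twistOfTensor N n`, `suCenter`) and `QuantumLattice/TwistedSectorClassicalRate.lean`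
(namespace `TwistedSector`: `twistZ ρ z β L : ℝ`, the object of the `β → ∞` rate theorem `twistFreeEnergy_rate`).  THEOREMS ONLY.

K. R. Ito, E. Seiler, arXiv:0803.3019 [ItoSeiler2008Further] §2 Thm 2.2 (1): "Let `G = U(1)` or `G = SU(2)`. Then there is a `β₁ > 0`
such that for `β < β₁`" the vortex free energy obeys the area decay law; "The analogous statement for `SU(N)` holds with `Z⁻` replaced
by `Z^ω`".  E. T. Tomboulis, arXiv:0707.2179 [Tomboulis2007Confinement] §6.2 (6.10)–(6.14): in the convergent expansion `ln Z⁻ - ln Z`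
is a sum over clusters containing a topologically non-trivial polymer, of size `≥ A` (6.11).  G. 't Hooft, Nucl. Phys. B153 (1979) 141
[tHooft1979Flux] §2 (2.2)–(2.6) defines the partition functions `W{n; a_μ}` with a centre twist `n_{μν}` on EVERY plane.  The
one-plane case is `CentralTwistFluxRemoval.lean` / `CentralTwistTensorForm.lean` (HONEST FRAMING there: "general twist tensors
`n_{μν}` with several non-zero entries are not treated").  Here:

* `polymerLogZ_sub_polymerLogZ_eq_of_agree`, `sum_norm_truncatedWeight_le_of_large_field`,
  ★ `abs_log_fieldZ_sub_log_fieldZ_le_of_agree`, `one_sub_fieldZ_div_le_card_mul_exp_of_agree`, `one_sub_fieldZ_div_le_of_agree`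
  — for ANY two measurable families in the Kotecký–Preiss region `(8(d-1)+1)² e² ε ≤ 1/2` whose polymer activities agree on
  polymers with fewer than `L²` plaquettes: `|ln Z₁ - ln Z₂| ≤ 2·#plaq·e^{-L²}` and `1 - Z₂/Z₁ ≤ 2d² L^{d-2} e^{-L²/2}`;
* ★ `one_sub_fieldZ_twistInsertion_div_le` — every twist `z : Twist d G` versus the untwisted family, any family `w`;
* Wilson bridges `insertedPartitionFunction_eq_mul_fieldZ`, `twistZ_eq_insertedPartitionFunction_twistInsertion`;
* ★★ `one_sub_insertedPartitionFunction_div_le` (any two twists `z₁, z₂`, any background insertion),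
  ★★ `one_sub_twistZ_div_twistZ_le` — `1 - Z_{z₂}(β)/Z_{z₁}(β) ≤ 2d² L^{d-2} e^{-L²/2}` for ALL twists of a second-countable
  compact `G`, continuous `ρ : G →* M_N(ℂ)`, `|β| ≤ 1/(4N (8(d-1)+1)² e²)` (`TwistedSector.twistZ`, the `β → 0` companion of
  `TwistedSector.twistFreeEnergy_rate`), ★★ `one_sub_twistedPartitionFunction_toReal_div_le` (the `ℝ≥0∞` twist-tensor form),
  `abs_log_twistZ_sub_log_twistZ_le` (the twist free energy `|ln Z_{z₁} - ln Z_{z₂}| ≤ 2d² L^d e^{-L²}`);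
* ★★ `sun_one_sub_twistedPartitionFunction_tensor_div_le_general` — `SU(N)`, ANY twist tensors `n₁, n₂ : Plane d → ZMod N`;
  `u1_one_sub_twistedPartitionFunction_div_le_general` — `U(1)`, any phases on all planes.

HONEST FRAMING: symmetric tori `(ℤ/Lℤ)^d`, `d ≥ 2`; strong coupling only; nothing about large `β`, electric-flux Fourier transforms,
(5.15)/(5.16) or any limit.  The constant is the one-plane constant: ALL twisted planes are removed from a small polymer at once.
-/

noncomputable section

open MeasureTheory Finset
open scoped BigOperators
open Literature.MathematicalPhysics.QuantumLattice
open Literature.Probability.LatticeModels (IsRConnected GeomInc Touches)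

namespace Literature.MathematicalPhysics.QuantumFieldTheory

namespace CentralTwist

open Tomboulis2007

variable {d L : ℕ} {G : Type*} [Group G]

/-! ## Two families with the same small-polymer activities -/

section Agree

variable [TopologicalSpace G] [IsTopologicalGroup G] [CompactSpace G] [MeasurableSpace G] [BorelSpace G]
  [SecondCountableTopology G] [NeZero L]

open Literature.Probability.LatticeModels

omit [TopologicalSpace G] [IsTopologicalGroup G] [CompactSpace G] [MeasurableSpace G] [BorelSpace G]
  [SecondCountableTopology G] [NeZero L] in
/-- Covering bound (plumbing). [folklore] -/
private theorem sum_le_sum_sum_of_cover_F {ι κ : Type*} [DecidableEq ι] (𝒞 : Finset ι) (P : Finset κ)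
    (S : κ → Finset ι) {g : ι → ℝ} (hg : ∀ C, 0 ≤ g C) (hcover : ∀ C ∈ 𝒞, ∃ p ∈ P, C ∈ S p) :
    ∑ C ∈ 𝒞, g C ≤ ∑ p ∈ P, ∑ C ∈ S p, g C := by
  classical
  calc ∑ C ∈ 𝒞, g C ≤ ∑ C ∈ 𝒞, ∑ p ∈ P with C ∈ S p, g C := by
        refine Finset.sum_le_sum fun C hC => ?_
        obtain ⟨p, hp, hR⟩ := hcover C hC
        rw [Finset.sum_const, nsmul_eq_mul]
        have h1 : (1 : ℝ) ≤ (P.filter fun p => C ∈ S p).card := by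
          exact_mod_cast Finset.card_pos.2 ⟨p, Finset.mem_filter.2 ⟨hp, hR⟩⟩
        nlinarith [hg C]
    _ = ∑ p ∈ P, ∑ C ∈ 𝒞 with C ∈ S p, g C := by
        rw [Finset.sum_comm' (t' := P) (s' := fun p => 𝒞.filter fun C => C ∈ S p)]
        intro C p
        simp only [Finset.mem_filter]
        tauto
    _ ≤ ∑ p ∈ P, ∑ C ∈ S p, g C := Finset.sum_le_sum fun p _ =>
        Finset.sum_le_sum_of_subset_of_nonneg (fun C hC => (Finset.mem_filter.1 hC).2) fun C _ _ => hg C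

omit [SecondCountableTopology G] in
/-- **(6.10) for two families with the same small-polymer activities**: their Kotecký–Preiss logarithms differ only by the
truncated functionals of clusters containing a polymer with at least `L²` plaquettes. [cite: Tomboulis2007Confinement, §6.2 eq. (6.10)]
[cite: KoteckyPreiss1986, (2) and Proposition p. 494 (i)] -/
theorem polymerLogZ_sub_polymerLogZ_eq_of_agree {w₁ w₂ : Plaquette d L → G → ℝ}
    (hagree : ∀ X : Finset (Plaquette d L), X.card < L ^ 2 → fieldPolymerActivity w₁ X = fieldPolymerActivity w₂ X) :
    polymerLogZ (GeomInc linkRel) (fieldPolymerActivity w₁) (torusPolymers d L) -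
        polymerLogZ (GeomInc linkRel) (fieldPolymerActivity w₂) (torusPolymers d L) =
      ∑ C ∈ (torusPolymers d L).powerset with
          (C ∩ (torusPolymers d L).filter fun X => L ^ 2 ≤ X.card).Nonempty,
        (truncatedWeight (GeomInc linkRel) (fieldPolymerActivity w₁) C -
          truncatedWeight (GeomInc linkRel) (fieldPolymerActivity w₂) C) := by
  refine polymerLogZ_sub_eq_sum_filter _ _ fun γ hγ hγT => ?_
  have hlt : γ.card < L ^ 2 := by
    by_contra h
    exact hγT (Finset.mem_filter.2 ⟨hγ, not_lt.1 h⟩)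
  exact hagree γ hlt

omit [SecondCountableTopology G] in
/-- The tail estimate for a family of clusters each containing a polymer with `≥ L²` plaquettes (any group, any family of
weights in the Kotecký–Preiss region). [cite: KoteckyPreiss1986, Theorem p. 492, estimate (4)] -/
theorem sum_norm_truncatedWeight_le_of_large_field {w : Plaquette d L → G → ℝ} {ε : ℝ} (hε : ∀ p W, |w p W - 1| ≤ ε)
    (hsmall : (((8 * (d - 1) : ℕ) : ℝ) + 1) ^ 2 * (Real.exp 2 * ε) ≤ 1 / 2)
    (𝒞 : Finset (Finset (Finset (Plaquette d L))))
    (hlarge : ∀ C ∈ 𝒞, ∃ X ∈ C, X ∈ torusPolymers d L ∧ L ^ 2 ≤ X.card) :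
    ∑ C ∈ 𝒞, ‖truncatedWeight (GeomInc linkRel) (fieldPolymerActivity w) C‖ ≤
      (Fintype.card (Plaquette d L) : ℝ) * Real.exp (-((L : ℝ) ^ 2)) := by
  classical
  haveI : Std.Refl (GeomInc (linkRel (d := d) (L := L))) := ⟨geomInc_refl _⟩
  haveI : Std.Symm (GeomInc (linkRel (d := d) (L := L))) := ⟨fun _ _ h => geomInc_symm _ linkRel_symm h⟩
  have hfact := koteckyPreiss_truncatedWeight_bound_holds (GeomInc linkRel) (fieldPolymerActivity w)
    (fun X : Finset (Plaquette d L) => (X.card : ℝ)) (fun X : Finset (Plaquette d L) => (X.card : ℝ))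
  have h1 := kp_hypothesis_fieldPolymerActivity_tsum hε hsmall
  have hsize : ∀ C ∈ 𝒞, ((L : ℝ) ^ 2) ≤ ∑ γ' ∈ C, ((γ'.card : ℕ) : ℝ) := by
    intro C hC
    obtain ⟨X, hXC, -, hXL⟩ := hlarge C hC
    have h := Finset.single_le_sum (f := fun γ' : Finset (Plaquette d L) => ((γ'.card : ℕ) : ℝ))
      (fun γ' _ => Nat.cast_nonneg _) hXC
    exact le_trans (by exact_mod_cast hXL) h
  have hstep := fun p : Plaquette d L => sum_norm_truncatedWeight_le_exp_neg_of_touches hfact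
    (fun _ => Nat.cast_nonneg _) (fun _ => Nat.cast_nonneg _) h1 𝒞 {p} (r := (L : ℝ) ^ 2)
    (fun C hC _ => hsize C hC)
  have hsum := Finset.sum_le_sum fun p (_ : p ∈ (Finset.univ : Finset (Plaquette d L))) => hstep p
  refine ((sum_le_sum_sum_of_cover_F 𝒞 Finset.univ _ (fun C => norm_nonneg _) ?_).trans hsum).trans (le_of_eq ?_)
  · intro C hC
    obtain ⟨X, hXC, hXP, -⟩ := hlarge C hC
    obtain ⟨p, hp⟩ := nonempty_of_mem_torusPolymers hXP
    exact ⟨p, Finset.mem_univ _, Finset.mem_filter.2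
      ⟨hC, X, hXC, Or.inr ⟨p, hp, p, Finset.mem_singleton_self p, Or.inl rfl⟩⟩⟩
  · simp only [Finset.card_singleton, Nat.cast_one, mul_one, Finset.sum_const, Finset.card_univ, nsmul_eq_mul]

/-- **★ `|ln Z₁ - ln Z₂| ≤ 2 · #plaquettes · e^{-L²}`** for two measurable families in the Kotecký–Preiss region whose
polymer activities agree on every polymer with fewer than `L²` plaquettes (arXiv:0707.2179 (6.10)–(6.12): only clusters with a
polymer of size `≥ A = L²` survive in the difference of the logarithms). [cite: Tomboulis2007Confinement, §6.2 eqs. (6.10)–(6.12)]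
[cite: KoteckyPreiss1986, Theorem p. 492, estimate (4)] -/
theorem abs_log_fieldZ_sub_log_fieldZ_le_of_agree {w₁ w₂ : Plaquette d L → G → ℝ}
    (hw₁ : ∀ p, Measurable (w₁ p)) (hw₂ : ∀ p, Measurable (w₂ p)) {ε : ℝ}
    (hε₁ : ∀ p W, |w₁ p W - 1| ≤ ε) (hε₂ : ∀ p W, |w₂ p W - 1| ≤ ε)
    (hsmall : (((8 * (d - 1) : ℕ) : ℝ) + 1) ^ 2 * (Real.exp 2 * ε) ≤ 1 / 2)
    (hagree : ∀ X : Finset (Plaquette d L), X.card < L ^ 2 → fieldPolymerActivity w₁ X = fieldPolymerActivity w₂ X) :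
    |Real.log (fieldZ d L w₁) - Real.log (fieldZ d L w₂)| ≤
      2 * (Fintype.card (Plaquette d L) : ℝ) * Real.exp (-((L : ℝ) ^ 2)) := by
  set ℓ₁ := polymerLogZ (GeomInc linkRel) (fieldPolymerActivity w₁) (torusPolymers d L) with hℓ₁
  set ℓ₂ := polymerLogZ (GeomInc linkRel) (fieldPolymerActivity w₂) (torusPolymers d L) with hℓ₂
  have hlog₁ : Real.log (fieldZ d L w₁) = ℓ₁.re := log_fieldZ_eq_re_polymerLogZ hw₁ hε₁ hsmall
  have hlog₂ : Real.log (fieldZ d L w₂) = ℓ₂.re := log_fieldZ_eq_re_polymerLogZ hw₂ hε₂ hsmall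
  calc |Real.log (fieldZ d L w₁) - Real.log (fieldZ d L w₂)|
      = |(ℓ₁ - ℓ₂).re| := by rw [Complex.sub_re, hlog₁, hlog₂]
    _ ≤ ‖ℓ₁ - ℓ₂‖ := Complex.abs_re_le_norm _
    _ = ‖∑ C ∈ (torusPolymers d L).powerset with
            (C ∩ (torusPolymers d L).filter fun X => L ^ 2 ≤ X.card).Nonempty,
          (truncatedWeight (GeomInc linkRel) (fieldPolymerActivity w₁) C -
            truncatedWeight (GeomInc linkRel) (fieldPolymerActivity w₂) C)‖ := by
        rw [hℓ₁, hℓ₂, polymerLogZ_sub_polymerLogZ_eq_of_agree hagree]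
    _ ≤ ∑ C ∈ (torusPolymers d L).powerset with
            (C ∩ (torusPolymers d L).filter fun X => L ^ 2 ≤ X.card).Nonempty,
          (‖truncatedWeight (GeomInc linkRel) (fieldPolymerActivity w₁) C‖ +
            ‖truncatedWeight (GeomInc linkRel) (fieldPolymerActivity w₂) C‖) :=
        (norm_sum_le _ _).trans (Finset.sum_le_sum fun C _ => norm_sub_le _ _)
    _ ≤ (Fintype.card (Plaquette d L) : ℝ) * Real.exp (-((L : ℝ) ^ 2)) +
          (Fintype.card (Plaquette d L) : ℝ) * Real.exp (-((L : ℝ) ^ 2)) := by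
        rw [Finset.sum_add_distrib]
        have hl : ∀ C ∈ (torusPolymers d L).powerset.filter (fun C =>
            (C ∩ (torusPolymers d L).filter fun X => L ^ 2 ≤ X.card).Nonempty),
            ∃ X ∈ C, X ∈ torusPolymers d L ∧ L ^ 2 ≤ X.card := by
          intro C hC
          obtain ⟨X, hX⟩ := (Finset.mem_filter.1 hC).2
          rw [Finset.mem_inter, Finset.mem_filter] at hX
          exact ⟨X, hX.1, hX.2.1, hX.2.2⟩
        exact add_le_add (sum_norm_truncatedWeight_le_of_large_field hε₁ hsmall _ hl)
          (sum_norm_truncatedWeight_le_of_large_field hε₂ hsmall _ hl)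
    _ = 2 * (Fintype.card (Plaquette d L) : ℝ) * Real.exp (-((L : ℝ) ^ 2)) := by ring

/-- **`1 - Z₂/Z₁ ≤ 2 · #plaquettes · e^{-L²}`** for two families as in `abs_log_fieldZ_sub_log_fieldZ_le_of_agree`
(`1 - x ≤ -ln x`). [cite: Tomboulis2007Confinement, §6.2 eqs. (6.10)–(6.12)] [cite: ItoSeiler2008Further, §2 Thm 2.2 (1)] -/
theorem one_sub_fieldZ_div_le_card_mul_exp_of_agree {w₁ w₂ : Plaquette d L → G → ℝ}
    (hw₁ : ∀ p, Measurable (w₁ p)) (hw₂ : ∀ p, Measurable (w₂ p)) {ε : ℝ}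
    (hε₁ : ∀ p W, |w₁ p W - 1| ≤ ε) (hε₂ : ∀ p W, |w₂ p W - 1| ≤ ε)
    (hsmall : (((8 * (d - 1) : ℕ) : ℝ) + 1) ^ 2 * (Real.exp 2 * ε) ≤ 1 / 2)
    (hagree : ∀ X : Finset (Plaquette d L), X.card < L ^ 2 → fieldPolymerActivity w₁ X = fieldPolymerActivity w₂ X) :
    1 - fieldZ d L w₂ / fieldZ d L w₁ ≤ 2 * (Fintype.card (Plaquette d L) : ℝ) * Real.exp (-((L : ℝ) ^ 2)) := by
  have hZ₁ := fieldZ_pos_of_kpSmall (d := d) (L := L) hw₁ hε₁ hsmall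
  have hZ₂ := fieldZ_pos_of_kpSmall (d := d) (L := L) hw₂ hε₂ hsmall
  have hratio : 0 < fieldZ d L w₂ / fieldZ d L w₁ := div_pos hZ₂ hZ₁
  calc 1 - fieldZ d L w₂ / fieldZ d L w₁ ≤ -Real.log (fieldZ d L w₂ / fieldZ d L w₁) := by
        linarith [Real.log_le_sub_one_of_pos hratio]
    _ = Real.log (fieldZ d L w₁) - Real.log (fieldZ d L w₂) := by
        rw [Real.log_div hZ₂.ne' hZ₁.ne']
        ring
    _ ≤ |Real.log (fieldZ d L w₁) - Real.log (fieldZ d L w₂)| := le_abs_self _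
    _ ≤ 2 * (Fintype.card (Plaquette d L) : ℝ) * Real.exp (-((L : ℝ) ^ 2)) :=
        abs_log_fieldZ_sub_log_fieldZ_le_of_agree hw₁ hw₂ hε₁ hε₂ hsmall hagree

omit [TopologicalSpace G] [IsTopologicalGroup G] [CompactSpace G] [MeasurableSpace G] [BorelSpace G]
  [SecondCountableTopology G] in
/-- `#plaquettes ≤ d² L^d` (plumbing). [folklore] -/
private theorem card_plaquette_le_F : (Fintype.card (Plaquette d L) : ℝ) ≤ (d : ℝ) ^ 2 * (L : ℝ) ^ d := by
  classical
  have h : Fintype.card (Plaquette d L) ≤ d ^ 2 * L ^ d := by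
    rw [Fintype.card_prod]
    have hS : Fintype.card (Site d L) = L ^ d := by
      rw [Fintype.card_pi, Finset.prod_const, ZMod.card, Finset.card_univ, Fintype.card_fin]
    have hP : Fintype.card {p : Fin d × Fin d // p.1 < p.2} ≤ d ^ 2 := by
      refine (Fintype.card_subtype_le _).trans ?_
      rw [Fintype.card_prod, Fintype.card_fin, sq]
    rw [hS, mul_comm]
    exact Nat.mul_le_mul_right _ hP
  exact_mod_cast h

omit [TopologicalSpace G] [IsTopologicalGroup G] [CompactSpace G] [MeasurableSpace G] [BorelSpace G]
  [SecondCountableTopology G] [NeZero L] in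
/-- `x ≤ e^{x/2}` for `x ≥ 0` (plumbing). [folklore] -/
private theorem le_exp_half_F {x : ℝ} (hx : 0 ≤ x) : x ≤ Real.exp (x / 2) := by
  have h := Real.add_one_le_exp (x / 4)
  have h2 : Real.exp (x / 2) = Real.exp (x / 4) ^ 2 := by
    rw [← Real.exp_nat_mul]; ring_nf
  rw [h2]
  nlinarith [sq_nonneg (1 - x / 4), Real.exp_pos (x / 4)]

omit [TopologicalSpace G] [IsTopologicalGroup G] [CompactSpace G] [MeasurableSpace G] [BorelSpace G]
  [SecondCountableTopology G] [NeZero L] in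
/-- `L^d e^{-L²} ≤ L^{d-2} e^{-L²/2}` for `d ≥ 2` (plumbing). [folklore] -/
private theorem pow_mul_exp_neg_sq_le_F (hd : 2 ≤ d) (L : ℕ) :
    (L : ℝ) ^ d * Real.exp (-((L : ℝ) ^ 2)) ≤ (L : ℝ) ^ (d - 2) * Real.exp (-(1 / 2 * (L : ℝ) ^ 2)) := by
  have hL2 : (0 : ℝ) ≤ (L : ℝ) ^ 2 := by positivity
  have hx := le_exp_half_F hL2
  have hsplit : (L : ℝ) ^ d = (L : ℝ) ^ (d - 2) * (L : ℝ) ^ 2 := by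
    rw [← pow_add, Nat.sub_add_cancel hd]
  have hexp : Real.exp (-((L : ℝ) ^ 2)) = Real.exp (-(1 / 2 * (L : ℝ) ^ 2)) * Real.exp (-((L : ℝ) ^ 2 / 2)) := by
    rw [← Real.exp_add]; ring_nf
  rw [hsplit, hexp]
  have hkey : (L : ℝ) ^ 2 * Real.exp (-((L : ℝ) ^ 2 / 2)) ≤ 1 := by
    rw [Real.exp_neg]
    have hpos := Real.exp_pos ((L : ℝ) ^ 2 / 2)
    rw [mul_inv_le_iff₀ hpos, one_mul]
    exact hx
  have hnn : 0 ≤ (L : ℝ) ^ (d - 2) * Real.exp (-(1 / 2 * (L : ℝ) ^ 2)) := by positivity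
  calc (L : ℝ) ^ (d - 2) * (L : ℝ) ^ 2 * (Real.exp (-(1 / 2 * (L : ℝ) ^ 2)) * Real.exp (-((L : ℝ) ^ 2 / 2)))
      = ((L : ℝ) ^ (d - 2) * Real.exp (-(1 / 2 * (L : ℝ) ^ 2))) * ((L : ℝ) ^ 2 * Real.exp (-((L : ℝ) ^ 2 / 2))) := by
        ring
    _ ≤ ((L : ℝ) ^ (d - 2) * Real.exp (-(1 / 2 * (L : ℝ) ^ 2))) * 1 := mul_le_mul_of_nonneg_left hkey hnn
    _ = (L : ℝ) ^ (d - 2) * Real.exp (-(1 / 2 * (L : ℝ) ^ 2)) := mul_one _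

omit [TopologicalSpace G] [IsTopologicalGroup G] [CompactSpace G] [MeasurableSpace G] [BorelSpace G]
  [SecondCountableTopology G] in
/-- `2 · #plaq · e^{-L²} ≤ 2d² L^{d-2} e^{-L²/2}` for `d ≥ 2` (plumbing). [folklore] -/
private theorem two_card_exp_le_F (hd : 2 ≤ d) :
    2 * (Fintype.card (Plaquette d L) : ℝ) * Real.exp (-((L : ℝ) ^ 2)) ≤
      2 * (d : ℝ) ^ 2 * (L : ℝ) ^ (d - 2) * Real.exp (-(1 / 2 * (L : ℝ) ^ 2)) := by
  calc 2 * (Fintype.card (Plaquette d L) : ℝ) * Real.exp (-((L : ℝ) ^ 2))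
      ≤ 2 * ((d : ℝ) ^ 2 * (L : ℝ) ^ d) * Real.exp (-((L : ℝ) ^ 2)) :=
        mul_le_mul_of_nonneg_right (mul_le_mul_of_nonneg_left card_plaquette_le_F (by norm_num)) (Real.exp_nonneg _)
    _ = 2 * (d : ℝ) ^ 2 * ((L : ℝ) ^ d * Real.exp (-((L : ℝ) ^ 2))) := by ring
    _ ≤ 2 * (d : ℝ) ^ 2 * ((L : ℝ) ^ (d - 2) * Real.exp (-(1 / 2 * (L : ℝ) ^ 2))) :=
        mul_le_mul_of_nonneg_left (pow_mul_exp_neg_sq_le_F hd L) (by positivity)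
    _ = 2 * (d : ℝ) ^ 2 * (L : ℝ) ^ (d - 2) * Real.exp (-(1 / 2 * (L : ℝ) ^ 2)) := by ring

/-- **`1 - Z₂/Z₁ ≤ 2d² L^{d-2} e^{-L²/2}`** (`d ≥ 2`) for two measurable families in the Kotecký–Preiss region with the same
small-polymer activities. [cite: Tomboulis2007Confinement, §6.2 eqs. (6.10)–(6.14)] [cite: ItoSeiler2008Further, §2 Thm 2.2 (1)] -/
theorem one_sub_fieldZ_div_le_of_agree (hd : 2 ≤ d) {w₁ w₂ : Plaquette d L → G → ℝ}
    (hw₁ : ∀ p, Measurable (w₁ p)) (hw₂ : ∀ p, Measurable (w₂ p)) {ε : ℝ}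
    (hε₁ : ∀ p W, |w₁ p W - 1| ≤ ε) (hε₂ : ∀ p W, |w₂ p W - 1| ≤ ε)
    (hsmall : (((8 * (d - 1) : ℕ) : ℝ) + 1) ^ 2 * (Real.exp 2 * ε) ≤ 1 / 2)
    (hagree : ∀ X : Finset (Plaquette d L), X.card < L ^ 2 → fieldPolymerActivity w₁ X = fieldPolymerActivity w₂ X) :
    1 - fieldZ d L w₂ / fieldZ d L w₁ ≤ 2 * (d : ℝ) ^ 2 * (L : ℝ) ^ (d - 2) * Real.exp (-(1 / 2 * (L : ℝ) ^ 2)) :=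
  (one_sub_fieldZ_div_le_card_mul_exp_of_agree hw₁ hw₂ hε₁ hε₂ hsmall hagree).trans (two_card_exp_le_F hd)

/-- The logarithmic form: `|ln Z₁ - ln Z₂| ≤ 2d² L^{d-2} e^{-L²/2}` (`d ≥ 2`).
[cite: Tomboulis2007Confinement, §6.2 eqs. (6.10)–(6.14)] -/
theorem abs_log_fieldZ_sub_log_fieldZ_le_of_agree' (hd : 2 ≤ d) {w₁ w₂ : Plaquette d L → G → ℝ}
    (hw₁ : ∀ p, Measurable (w₁ p)) (hw₂ : ∀ p, Measurable (w₂ p)) {ε : ℝ}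
    (hε₁ : ∀ p W, |w₁ p W - 1| ≤ ε) (hε₂ : ∀ p W, |w₂ p W - 1| ≤ ε)
    (hsmall : (((8 * (d - 1) : ℕ) : ℝ) + 1) ^ 2 * (Real.exp 2 * ε) ≤ 1 / 2)
    (hagree : ∀ X : Finset (Plaquette d L), X.card < L ^ 2 → fieldPolymerActivity w₁ X = fieldPolymerActivity w₂ X) :
    |Real.log (fieldZ d L w₁) - Real.log (fieldZ d L w₂)| ≤
      2 * (d : ℝ) ^ 2 * (L : ℝ) ^ (d - 2) * Real.exp (-(1 / 2 * (L : ℝ) ^ 2)) :=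
  (abs_log_fieldZ_sub_log_fieldZ_le_of_agree hw₁ hw₂ hε₁ hε₂ hsmall hagree).trans (two_card_exp_le_F hd)

end Agree

/-! ## Every 't Hooft twist versus the untwisted family, any background -/

section Twists

variable [TopologicalSpace G] [IsTopologicalGroup G] [CompactSpace G] [MeasurableSpace G] [BorelSpace G]
  [SecondCountableTopology G] [NeZero L]

omit [IsTopologicalGroup G] [CompactSpace G] [SecondCountableTopology G] [NeZero L] in
/-- A twisted family is measurable if the family is (left translations are continuous). [folklore] -/
private theorem measurable_twistBy_F [ContinuousMul G] (t : Plaquette d L → G) {w : Plaquette d L → G → ℝ}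
    (hw : ∀ p, Measurable (w p)) (p : Plaquette d L) : Measurable (twistBy t w p) :=
  (hw p).comp (continuous_const_mul (t p)).measurable

omit [TopologicalSpace G] [IsTopologicalGroup G] [CompactSpace G] [MeasurableSpace G] [BorelSpace G]
  [SecondCountableTopology G] [NeZero L] in
/-- A twisted family is as close to `1` as the family (plumbing). [folklore] -/
private theorem abs_twistBy_sub_one_le_F (t : Plaquette d L → G) {w : Plaquette d L → G → ℝ} {ε : ℝ}
    (hε : ∀ p W, |w p W - 1| ≤ ε) : ∀ p W, |twistBy t w p W - 1| ≤ ε :=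
  fun p W => hε p (t p * W)

/-- **★ Every 't Hooft twist sector versus the untwisted one, for an arbitrary family of weights**: second-countable compact
`G`, measurable family `w` with `(8(d-1)+1)² e² sup_p sup|w_p - 1| ≤ 1/2`, `d ≥ 2`, and ANY twist `z : Twist d G` (centre elements
on all planes at once): `1 - Z_{w∘t_z}/Z_w ≤ 2d² L^{d-2} e^{-L²/2}` — twist locality for every twist
(`fieldPolymerActivity_twistInsertion_eq_of_card_lt`) fed into the two-family bound.
[cite: Tomboulis2007Confinement, §6.2 eqs. (6.10)–(6.14)] [cite: ItoSeiler2008Further, §2 Thm 2.2 (1)] [cite: tHooft1979Flux, §2 eqs. (2.5)–(2.6)] -/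
theorem one_sub_fieldZ_twistInsertion_div_le (hd : 2 ≤ d) (z : QuantumLattice.Twist d G) {w : Plaquette d L → G → ℝ}
    (hw : ∀ p, Measurable (w p)) {ε : ℝ} (hε : ∀ p W, |w p W - 1| ≤ ε)
    (hsmall : (((8 * (d - 1) : ℕ) : ℝ) + 1) ^ 2 * (Real.exp 2 * ε) ≤ 1 / 2) :
    1 - fieldZ d L (twistBy (twistInsertion z) w) / fieldZ d L w ≤
      2 * (d : ℝ) ^ 2 * (L : ℝ) ^ (d - 2) * Real.exp (-(1 / 2 * (L : ℝ) ^ 2)) :=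
  one_sub_fieldZ_div_le_of_agree hd hw (measurable_twistBy_F (twistInsertion z) hw) hε
    (abs_twistBy_sub_one_le_F (twistInsertion z) hε) hsmall
    fun _ hX => (fieldPolymerActivity_twistInsertion_eq_of_card_lt z w hX).symm

/-- **Two twist sectors compared directly, any background insertion `t`**: for twists `z₁, z₂` and a family `w` as above,
`1 - Z_{w∘(t·t_{z₂})}/Z_{w∘(t·t_{z₁})} ≤ 2d² L^{d-2} e^{-L²/2}`.
[cite: Tomboulis2007Confinement, §6.2 eqs. (6.10)–(6.14)] [cite: tHooft1979Flux, §2 eqs. (2.5)–(2.6)] -/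
theorem one_sub_fieldZ_twistInsertion_div_twistInsertion_le (hd : 2 ≤ d) (z₁ z₂ : QuantumLattice.Twist d G)
    (t : Plaquette d L → G) {w : Plaquette d L → G → ℝ} (hw : ∀ p, Measurable (w p)) {ε : ℝ}
    (hε : ∀ p W, |w p W - 1| ≤ ε) (hsmall : (((8 * (d - 1) : ℕ) : ℝ) + 1) ^ 2 * (Real.exp 2 * ε) ≤ 1 / 2) :
    1 - fieldZ d L (twistBy (fun p => t p * twistInsertion z₂ p) w) /
        fieldZ d L (twistBy (fun p => t p * twistInsertion z₁ p) w) ≤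
      2 * (d : ℝ) ^ 2 * (L : ℝ) ^ (d - 2) * Real.exp (-(1 / 2 * (L : ℝ) ^ 2)) :=
  one_sub_fieldZ_div_le_of_agree hd (measurable_twistBy_F _ hw) (measurable_twistBy_F _ hw)
    (abs_twistBy_sub_one_le_F _ hε) (abs_twistBy_sub_one_le_F _ hε) hsmall fun X hX => by
      rw [fieldPolymerActivity_twistInsertion_background_eq_of_card_lt z₁ t w hX,
        fieldPolymerActivity_twistInsertion_background_eq_of_card_lt z₂ t w hX]

/-- The twist free energy relative to any other sector, logarithmic form: `|ln Z_{w∘(t·t_{z₁})} - ln Z_{w∘(t·t_{z₂})}| ≤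
2 · #plaquettes · e^{-L²}`. [cite: Tomboulis2007Confinement, §6.2 eqs. (6.10)–(6.12)] [cite: tHooft1979Flux, §2 eqs. (2.5)–(2.6)] -/
theorem abs_log_fieldZ_twistInsertion_sub_le (z₁ z₂ : QuantumLattice.Twist d G) (t : Plaquette d L → G)
    {w : Plaquette d L → G → ℝ} (hw : ∀ p, Measurable (w p)) {ε : ℝ} (hε : ∀ p W, |w p W - 1| ≤ ε)
    (hsmall : (((8 * (d - 1) : ℕ) : ℝ) + 1) ^ 2 * (Real.exp 2 * ε) ≤ 1 / 2) :
    |Real.log (fieldZ d L (twistBy (fun p => t p * twistInsertion z₁ p) w)) -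
        Real.log (fieldZ d L (twistBy (fun p => t p * twistInsertion z₂ p) w))| ≤
      2 * (Fintype.card (Plaquette d L) : ℝ) * Real.exp (-((L : ℝ) ^ 2)) :=
  abs_log_fieldZ_sub_log_fieldZ_le_of_agree (measurable_twistBy_F _ hw) (measurable_twistBy_F _ hw)
    (abs_twistBy_sub_one_le_F _ hε) (abs_twistBy_sub_one_le_F _ hε) hsmall fun X hX => by
      rw [fieldPolymerActivity_twistInsertion_background_eq_of_card_lt z₁ t w hX,
        fieldPolymerActivity_twistInsertion_background_eq_of_card_lt z₂ t w hX]

end Twists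

/-! ## Wilson's action: the inserted and twisted partition functions of the tree -/

section Wilson

variable {N : ℕ} [TopologicalSpace G] [IsTopologicalGroup G] [CompactSpace G] [MeasurableSpace G] [BorelSpace G] [NeZero L]

omit [TopologicalSpace G] [IsTopologicalGroup G] [CompactSpace G] [MeasurableSpace G] [BorelSpace G] in
/-- Pointwise form of the Wilson Gibbs factor with insertions (plumbing). [folklore] -/
private theorem exp_neg_mul_sum_eq_pow_mul_prod_F (β : ℝ) (s : Plaquette d L → ℝ) :
    Real.exp (-(β * ∑ p : Plaquette d L, ((N : ℕ) - s p : ℝ))) =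
      Real.exp (-(β * N)) ^ Fintype.card (Plaquette d L) * ∏ p : Plaquette d L, Real.exp (β * s p) := by
  rw [Finset.mul_sum, ← Finset.sum_neg_distrib, Real.exp_sum, ← Finset.card_univ, ← Finset.prod_const,
    ← Finset.prod_mul_distrib]
  refine Finset.prod_congr rfl fun p _ => ?_
  rw [← Real.exp_add]
  congr 1
  ring

/-- **Bridge to `TwistedPartitionFunction.lean`**: the partition function with an arbitrary plaquette insertion `t` is
`e^{-βN#plaquettes}` times the partition function of Wilson's family twisted by `t`:
`insertedPartitionFunction ρ β L t = e^{-βN#plaq} · Z_{wilsonFamily ρ β ∘ t}`. [cite: Greensite2011Confinement, §4.4 (4.41), (4.44)]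
[cite: tHooft1979Flux, §2 eq. (2.6)] -/
theorem insertedPartitionFunction_eq_mul_fieldZ (ρ : G →* Matrix (Fin N) (Fin N) ℂ) (β : ℝ) (t : Plaquette d L → G) :
    insertedPartitionFunction ρ β L t =
      Real.exp (-(β * N)) ^ Fintype.card (Plaquette d L) * fieldZ d L (twistBy t (wilsonFamily ρ β)) := by
  unfold insertedPartitionFunction insertedWilsonAction fieldZ
  rw [← integral_const_mul]
  congr 1
  funext U
  rw [exp_neg_mul_sum_eq_pow_mul_prod_F β fun p => ((ρ (t p * plaquetteHolonomy U p.1 p.2.1.1 p.2.1.2)).trace).re]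
  rfl

/-- **Bridge to `TwistedSectorClassicalRate.lean`**: `TwistedSector.twistZ ρ z β L` (the real-valued 't Hooft twisted partition
function of the twist-tensor form) is the inserted partition function of the twist insertion `t_z`.
[cite: tHooft1979Flux, §2 eq. (2.6)] [cite: GarciaperezGonzalezarroyoOkawa2014, §6] -/
theorem twistZ_eq_insertedPartitionFunction_twistInsertion (ρ : G →* Matrix (Fin N) (Fin N) ℂ)
    (z : QuantumLattice.Twist d G) (β : ℝ) :
    TwistedSector.twistZ ρ z β L = insertedPartitionFunction ρ β L (twistInsertion z) := rfl

variable [SecondCountableTopology G]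

omit [MeasurableSpace G] [BorelSpace G] [SecondCountableTopology G] [NeZero L] in
/-- The strong-coupling smallness of Wilson's family: for `|β| ≤ 1/(4N (8(d-1)+1)² e²)` the weight `e^{β Re tr ρ(·)}` satisfies
`(8(d-1)+1)² e² sup|w - 1| ≤ 1/2` with `sup|w - 1| ≤ 2N|β|` (plumbing around `abs_exp_mul_re_trace_sub_one_le`).
[cite: ItoSeiler2008Further, §2 Thm 2.2 (1)] -/
theorem wilsonFamily_kpSmall (ρ : G →* Matrix (Fin N) (Fin N) ℂ) (hρ : Continuous ρ) {β : ℝ}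
    (hβ : |β| ≤ 1 / (4 * N * ((((8 * (d - 1) : ℕ) : ℝ) + 1) ^ 2 * Real.exp 2))) :
    (∀ (p : Plaquette d L) (W : G), |wilsonFamily ρ β p W - 1| ≤ 2 * N * |β|) ∧
      (((8 * (d - 1) : ℕ) : ℝ) + 1) ^ 2 * (Real.exp 2 * (2 * N * |β|)) ≤ 1 / 2 := by
  have hK : (1 : ℝ) ≤ (((8 * (d - 1) : ℕ) : ℝ) + 1) ^ 2 * Real.exp 2 := by
    have hD : (1 : ℝ) ≤ (((8 * (d - 1) : ℕ) : ℝ) + 1) ^ 2 := by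
      have : (0 : ℝ) ≤ ((8 * (d - 1) : ℕ) : ℝ) := Nat.cast_nonneg _
      nlinarith
    have he : (1 : ℝ) ≤ Real.exp 2 := Real.one_le_exp (by norm_num)
    nlinarith
  have hNβ : (N : ℝ) * |β| * (4 * ((((8 * (d - 1) : ℕ) : ℝ) + 1) ^ 2 * Real.exp 2)) ≤ 1 := by
    rcases Nat.eq_zero_or_pos N with hN | hN
    · simp [hN]
    · have hNpos : (0 : ℝ) < N := by exact_mod_cast hN
      have hden : (0 : ℝ) < 4 * N * ((((8 * (d - 1) : ℕ) : ℝ) + 1) ^ 2 * Real.exp 2) := by positivity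
      have h := hβ
      rw [le_div_iff₀ hden] at h
      linarith
  have hNβ1 : (N : ℝ) * |β| ≤ 1 := by
    have : (N : ℝ) * |β| * 4 ≤ (N : ℝ) * |β| * (4 * ((((8 * (d - 1) : ℕ) : ℝ) + 1) ^ 2 * Real.exp 2)) := by
      have h0 : 0 ≤ (N : ℝ) * |β| := by positivity
      nlinarith
    linarith
  refine ⟨fun p W => abs_exp_mul_re_trace_sub_one_le ρ hρ hNβ1 W, ?_⟩
  nlinarith [abs_nonneg β]

omit [IsTopologicalGroup G] [CompactSpace G] [SecondCountableTopology G] [NeZero L] in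
/-- Wilson's family is measurable (continuous `ρ`). [cite: ItoSeiler2007Tomboulis, §2 eq. (2.1a)] -/
theorem measurable_wilsonFamily (ρ : G →* Matrix (Fin N) (Fin N) ℂ) (hρ : Continuous ρ) (β : ℝ) (p : Plaquette d L) :
    Measurable (wilsonFamily ρ β p) :=
  measurable_exp_mul_re_trace ρ hρ β

/-- **★★ The strong-coupling bound on every 't Hooft twist sector of Wilson's theory, with any background insertion**
(arXiv:0707.2179 §6.2; Ito–Seiler 2008 Thm 2.2 (1) and its `SU(N)`/`Z^ω` remark; 't Hooft 1979 §2 (2.5)–(2.6)): for every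
second-countable compact `G`, continuous `ρ : G →* M_N(ℂ)`, `d ≥ 2`, `|β| ≤ 1/(4N (8(d-1)+1)² e²)`, every background insertion `t`
and EVERY pair of twists `z₁, z₂ : Twist d G`:
`1 - Z_{t·t_{z₂}}(β)/Z_{t·t_{z₁}}(β) ≤ 2d² L^{d-2} e^{-L²/2}` for `insertedPartitionFunction` on `(ℤ/Lℤ)^d`.
TODO(general form): asymmetric tori `L₃L₄ → ∞` at fixed `L₁L₂` as printed in IS08.
[cite: ItoSeiler2008Further, §2 Thm 2.2 (1)] [cite: Tomboulis2007Confinement, §6.2 eqs. (6.10)–(6.14)]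
[cite: tHooft1979Flux, §2 eqs. (2.5)–(2.6)] -/
theorem one_sub_insertedPartitionFunction_div_le (hd : 2 ≤ d) (ρ : G →* Matrix (Fin N) (Fin N) ℂ) (hρ : Continuous ρ)
    {β : ℝ} (hβ : |β| ≤ 1 / (4 * N * ((((8 * (d - 1) : ℕ) : ℝ) + 1) ^ 2 * Real.exp 2)))
    (t : Plaquette d L → G) (z₁ z₂ : QuantumLattice.Twist d G) :
    1 - insertedPartitionFunction ρ β L (fun p => t p * twistInsertion z₂ p) /
        insertedPartitionFunction ρ β L (fun p => t p * twistInsertion z₁ p) ≤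
      2 * (d : ℝ) ^ 2 * (L : ℝ) ^ (d - 2) * Real.exp (-(1 / 2 * (L : ℝ) ^ 2)) := by
  obtain ⟨hε, hsmall⟩ := wilsonFamily_kpSmall (d := d) (L := L) ρ hρ hβ
  rw [insertedPartitionFunction_eq_mul_fieldZ, insertedPartitionFunction_eq_mul_fieldZ]
  have hpos : 0 < Real.exp (-(β * N)) ^ Fintype.card (Plaquette d L) := pow_pos (Real.exp_pos _) _
  rw [mul_div_mul_left _ _ hpos.ne']
  exact one_sub_fieldZ_twistInsertion_div_twistInsertion_le hd z₁ z₂ t (measurable_wilsonFamily ρ hρ β) hε hsmall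

/-- **★★ Every twist sector versus periodic boundary conditions** (no background): `1 - Z_{t_z}(β)/Z(β) ≤ 2d² L^{d-2} e^{-L²/2}`
for `insertedPartitionFunction ρ β L (twistInsertion z)` against `insertedPartitionFunction ρ β L 1`.
[cite: ItoSeiler2008Further, §2 Thm 2.2 (1)] [cite: tHooft1979Flux, §2 eqs. (2.5)–(2.6)] -/
theorem one_sub_insertedPartitionFunction_twistInsertion_div_le (hd : 2 ≤ d) (ρ : G →* Matrix (Fin N) (Fin N) ℂ)
    (hρ : Continuous ρ) {β : ℝ} (hβ : |β| ≤ 1 / (4 * N * ((((8 * (d - 1) : ℕ) : ℝ) + 1) ^ 2 * Real.exp 2)))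
    (z : QuantumLattice.Twist d G) :
    1 - insertedPartitionFunction ρ β L (twistInsertion z) / insertedPartitionFunction ρ β L (fun _ : Plaquette d L => (1 : G)) ≤
      2 * (d : ℝ) ^ 2 * (L : ℝ) ^ (d - 2) * Real.exp (-(1 / 2 * (L : ℝ) ^ 2)) := by
  have h := one_sub_insertedPartitionFunction_div_le (L := L) hd ρ hρ hβ (fun _ : Plaquette d L => (1 : G)) 1 z
  simp only [one_mul, twistInsertion_one] at h
  exact h

/-- **★★ Ito–Seiler 2008 Thm 2.2 (1) ∕ Tomboulis 2007 §6.2 for EVERY 't Hooft twist sector, in the vocabulary of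
`TwistedSectorClassicalRate.lean`** — the `β → 0` companion of `TwistedSector.twistFreeEnergy_rate` (`β → ∞`): for every
second-countable compact `G`, continuous `ρ : G →* M_N(ℂ)`, `d ≥ 2`, `|β| ≤ 1/(4N (8(d-1)+1)² e²)` and ANY two twists
`z₁, z₂ : Twist d G` (all planes at once): `1 - Z_{z₂}(β)/Z_{z₁}(β) ≤ 2d² L^{d-2} e^{-L²/2}` on `(ℤ/Lℤ)^d`.  With `z₁ = 1` this is the
exponential (area-law) smallness of every twist free energy at strong coupling.
[cite: ItoSeiler2008Further, §2 Thm 2.2 (1)] [cite: Tomboulis2007Confinement, §6.2 eqs. (6.10)–(6.14)]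
[cite: tHooft1979Flux, §2 eqs. (2.5)–(2.6)] -/
theorem one_sub_twistZ_div_twistZ_le (hd : 2 ≤ d) (ρ : G →* Matrix (Fin N) (Fin N) ℂ) (hρ : Continuous ρ) {β : ℝ}
    (hβ : |β| ≤ 1 / (4 * N * ((((8 * (d - 1) : ℕ) : ℝ) + 1) ^ 2 * Real.exp 2))) (z₁ z₂ : QuantumLattice.Twist d G) :
    1 - TwistedSector.twistZ ρ z₂ β L / TwistedSector.twistZ ρ z₁ β L ≤
      2 * (d : ℝ) ^ 2 * (L : ℝ) ^ (d - 2) * Real.exp (-(1 / 2 * (L : ℝ) ^ 2)) := by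
  have h := one_sub_insertedPartitionFunction_div_le (L := L) hd ρ hρ hβ (fun _ : Plaquette d L => (1 : G)) z₁ z₂
  simp only [one_mul] at h
  exact h

/-- **The twist free energy at strong coupling, logarithmic two-sided form**: `|ln Z_{z₁}(β) - ln Z_{z₂}(β)| ≤ 2d² L^d e^{-L²}`
for any two twists (so `-ln(Z_z/Z_1)`, the free energy of the sector `z` — whose `β → ∞` rate is `TwistedSector.twistFreeEnergy_rate`
— is exponentially small in the area `L²` at strong coupling, uniformly in the sector).
[cite: Tomboulis2007Confinement, §6.2 eqs. (6.10)–(6.12)] [cite: tHooft1979Flux, §2 eqs. (2.5)–(2.6)] -/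
theorem abs_log_twistZ_sub_log_twistZ_le (ρ : G →* Matrix (Fin N) (Fin N) ℂ) (hρ : Continuous ρ) {β : ℝ}
    (hβ : |β| ≤ 1 / (4 * N * ((((8 * (d - 1) : ℕ) : ℝ) + 1) ^ 2 * Real.exp 2))) (z₁ z₂ : QuantumLattice.Twist d G) :
    |Real.log (TwistedSector.twistZ ρ z₁ β L) - Real.log (TwistedSector.twistZ ρ z₂ β L)| ≤
      2 * (d : ℝ) ^ 2 * (L : ℝ) ^ d * Real.exp (-((L : ℝ) ^ 2)) := by
  obtain ⟨hε, hsmall⟩ := wilsonFamily_kpSmall (d := d) (L := L) ρ hρ hβ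
  have hpos : 0 < Real.exp (-(β * N)) ^ Fintype.card (Plaquette d L) := pow_pos (Real.exp_pos _) _
  have hw := measurable_wilsonFamily (d := d) (L := L) ρ hρ β
  have hZ : ∀ z : QuantumLattice.Twist d G, 0 < fieldZ d L (twistBy (twistInsertion z) (wilsonFamily ρ β)) := fun z =>
    fieldZ_pos_of_kpSmall (measurable_twistBy_F _ hw) (abs_twistBy_sub_one_le_F _ hε) hsmall
  rw [twistZ_eq_insertedPartitionFunction_twistInsertion, twistZ_eq_insertedPartitionFunction_twistInsertion,
    insertedPartitionFunction_eq_mul_fieldZ, insertedPartitionFunction_eq_mul_fieldZ, Real.log_mul hpos.ne' (hZ z₁).ne',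
    Real.log_mul hpos.ne' (hZ z₂).ne', add_sub_add_left_eq_sub]
  have h := abs_log_fieldZ_twistInsertion_sub_le (L := L) z₁ z₂ (fun _ : Plaquette d L => (1 : G)) hw hε hsmall
  simp only [one_mul] at h
  refine h.trans ?_
  calc 2 * (Fintype.card (Plaquette d L) : ℝ) * Real.exp (-((L : ℝ) ^ 2))
      ≤ 2 * ((d : ℝ) ^ 2 * (L : ℝ) ^ d) * Real.exp (-((L : ℝ) ^ 2)) :=
        mul_le_mul_of_nonneg_right (mul_le_mul_of_nonneg_left card_plaquette_le_F (by norm_num)) (Real.exp_nonneg _)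
    _ = 2 * (d : ℝ) ^ 2 * (L : ℝ) ^ d * Real.exp (-((L : ℝ) ^ 2)) := by ring

/-- **★★ The twist-tensor (`ℝ≥0∞`) form of `TwistedBoundaryConditions.lean`**: for every second-countable compact `G`,
continuous `ρ`, `d ≥ 2`, `|β| ≤ 1/(4N (8(d-1)+1)² e²)` and ANY twists `z₁, z₂ : Twist d G`:
`1 - (Z_{z₂}(β)).toReal/(Z_{z₁}(β)).toReal ≤ 2d² L^{d-2} e^{-L²/2}` for `QuantumLattice.twistedPartitionFunction`.
[cite: ItoSeiler2008Further, §2 Thm 2.2 (1)] [cite: tHooft1979Flux, §2 eqs. (2.5)–(2.6)] -/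
theorem one_sub_twistedPartitionFunction_toReal_div_le (hd : 2 ≤ d) (ρ : G →* Matrix (Fin N) (Fin N) ℂ)
    (hρ : Continuous ρ) {β : ℝ} (hβ : |β| ≤ 1 / (4 * N * ((((8 * (d - 1) : ℕ) : ℝ) + 1) ^ 2 * Real.exp 2)))
    (z₁ z₂ : QuantumLattice.Twist d G) :
    1 - (QuantumLattice.twistedPartitionFunction (L := L) ρ z₂ β).toReal /
        (QuantumLattice.twistedPartitionFunction (L := L) ρ z₁ β).toReal ≤
      2 * (d : ℝ) ^ 2 * (L : ℝ) ^ (d - 2) * Real.exp (-(1 / 2 * (L : ℝ) ^ 2)) := by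
  rw [TwistedSector.toReal_twistedPartitionFunction ρ hρ, TwistedSector.toReal_twistedPartitionFunction ρ hρ]
  exact one_sub_twistZ_div_twistZ_le hd ρ hρ hβ z₁ z₂

end Wilson

/-! ## `SU(N)` with arbitrary twist tensors, `U(1)` with arbitrary phases on every plane -/

section Instances

/-- **★★ Ito–Seiler 2008 Thm 2.2 (1), `SU(N)` with a GENERAL twist tensor** ('t Hooft 1979 (2.5): `z_{μν} = e^{2πi n_{μν}/N}` on
every plane; IS08: "The analogous statement for `SU(N)` holds with `Z⁻` replaced by `Z^ω`"): for the fundamental Wilson action,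
`d ≥ 2`, `|β| ≤ 1/(4N (8(d-1)+1)² e²)` and ANY two twist tensors `n₁, n₂ : Plane d → ZMod N` (several non-zero entries allowed):
`1 - Z_{n₂}(β)/Z_{n₁}(β) ≤ 2d² L^{d-2} e^{-L²/2}` on every symmetric torus `(ℤ/Lℤ)^d` (partition functions of `sunTwistedWilsonMeasure`).
[cite: ItoSeiler2008Further, §2 Thm 2.2 (1) (text after the theorem)] [cite: tHooft1979Flux, §2 eqs. (2.5)–(2.6)] -/
theorem sun_one_sub_twistedPartitionFunction_tensor_div_le_general {d : ℕ} (hd : 2 ≤ d) (N : ℕ) {β : ℝ}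
    (hβ : |β| ≤ 1 / (4 * N * ((((8 * (d - 1) : ℕ) : ℝ) + 1) ^ 2 * Real.exp 2))) {L : ℕ} [NeZero L]
    (n₁ n₂ : QuantumLattice.Plane d → ZMod N) :
    1 - (QuantumLattice.twistedPartitionFunction (L := L) (fundamentalRep (Fin N)) (QuantumLattice.twistOfTensor N n₂) β).toReal /
        (QuantumLattice.twistedPartitionFunction (L := L) (fundamentalRep (Fin N)) (QuantumLattice.twistOfTensor N n₁) β).toReal ≤
      2 * (d : ℝ) ^ 2 * (L : ℝ) ^ (d - 2) * Real.exp (-(1 / 2 * (L : ℝ) ^ 2)) := by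
  haveI : SecondCountableTopology (Matrix (Fin N) (Fin N) ℂ) :=
    inferInstanceAs (SecondCountableTopology (Fin N → Fin N → ℂ))
  haveI : SecondCountableTopology (Matrix.specialUnitaryGroup (Fin N) ℂ) :=
    TopologicalSpace.Subtype.secondCountableTopology _
  exact one_sub_twistedPartitionFunction_toReal_div_le hd (fundamentalRep (Fin N)) (continuous_fundamentalRep (Fin N)) hβ _ _

/-- The same against periodic boundary conditions (`n₁ = 0`): `1 - Z_n(β)/Z_0(β) ≤ 2d² L^{d-2} e^{-L²/2}` for every twist tensor `n`.
[cite: ItoSeiler2008Further, §2 Thm 2.2 (1) (text after the theorem)] [cite: tHooft1979Flux, §2 eqs. (2.5)–(2.6)] -/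
theorem sun_one_sub_twistedPartitionFunction_tensor_div_untwisted_le {d : ℕ} (hd : 2 ≤ d) (N : ℕ) {β : ℝ}
    (hβ : |β| ≤ 1 / (4 * N * ((((8 * (d - 1) : ℕ) : ℝ) + 1) ^ 2 * Real.exp 2))) {L : ℕ} [NeZero L]
    (n : QuantumLattice.Plane d → ZMod N) :
    1 - (QuantumLattice.twistedPartitionFunction (L := L) (fundamentalRep (Fin N)) (QuantumLattice.twistOfTensor N n) β).toReal /
        (QuantumLattice.twistedPartitionFunction (L := L) (fundamentalRep (Fin N))
          (QuantumLattice.twistOfTensor (d := d) N 0) β).toReal ≤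
      2 * (d : ℝ) ^ 2 * (L : ℝ) ^ (d - 2) * Real.exp (-(1 / 2 * (L : ℝ) ^ 2)) :=
  sun_one_sub_twistedPartitionFunction_tensor_div_le_general hd N hβ 0 n

/-- **`U(1)` with an arbitrary twist phase on every plane** (IS08 Remark 2.1 (3): "The center of `G = U(1)` is again `U(1)` …
`U_ω(p) = exp(i(θ_p + ω))`"): for ANY two twists `ω₁, ω₂ : Plane d → Z(U(1)) = U(1)`, `d ≥ 2` and `|β| ≤ 1/(4 (8(d-1)+1)² e²)`:
`1 - Z_{ω₂}(β)/Z_{ω₁}(β) ≤ 2d² L^{d-2} e^{-L²/2}`. [cite: ItoSeiler2008Further, §2 Thm 2.2 (1) and Remark 2.1 (3)] -/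
theorem u1_one_sub_twistZ_div_le_general [MeasurableSpace Circle] [BorelSpace Circle] {d : ℕ} (hd : 2 ≤ d) {β : ℝ}
    (hβ : |β| ≤ 1 / (4 * ((((8 * (d - 1) : ℕ) : ℝ) + 1) ^ 2 * Real.exp 2))) {L : ℕ} [NeZero L]
    (ω₁ ω₂ : QuantumLattice.Twist d Circle) :
    1 - TwistedSector.twistZ u1Rep ω₂ β L / TwistedSector.twistZ u1Rep ω₁ β L ≤
      2 * (d : ℝ) ^ 2 * (L : ℝ) ^ (d - 2) * Real.exp (-(1 / 2 * (L : ℝ) ^ 2)) := by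
  have hβ' : |β| ≤ 1 / (4 * (1 : ℕ) * ((((8 * (d - 1) : ℕ) : ℝ) + 1) ^ 2 * Real.exp 2)) := by
    simpa using hβ
  exact one_sub_twistZ_div_twistZ_le hd u1Rep continuous_u1Rep hβ' ω₁ ω₂

end Instances

end CentralTwist

end Literature.MathematicalPhysics.QuantumFieldTheory

end

/-! ## Revision 1 (append-only, lit-2 g25): plaquette-dependent (anisotropic) couplings `β_p`

't Hooft's boxes have unequal sides `a_μ` (Nucl. Phys. B153 (1979) 141, §2 (2.6): `W{n; a_μ}`); Ito–Seiler 2008 Thm 2.2 (1) takes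
`L₃L₄ → ∞` at fixed `L₁L₂`.  On the symmetric torus `(ℤ/Lℤ)^d` of this tree, unequal physical extents are emulated by ANISOTROPIC
couplings (a coupling `β_p` per plaquette, e.g. `β_t ≠ β_s`); since the expansion of this file is for arbitrary plaquette-dependent
weight families, the twist-sector bound holds verbatim for Wilson's action with any couplings `|β_p| ≤ 1/(4N (8(d-1)+1)² e²)`.
Theorems only; the asymmetric-torus statement itself remains TODO(general form).
-/

namespace Literature.MathematicalPhysics.QuantumFieldTheory

namespace CentralTwist

open MeasureTheory Finset
open Literature.MathematicalPhysics.QuantumLattice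

variable {d L : ℕ} {G : Type*} [Group G] {N : ℕ} [TopologicalSpace G] [IsTopologicalGroup G] [CompactSpace G]
  [MeasurableSpace G] [BorelSpace G] [SecondCountableTopology G] [NeZero L]

omit [MeasurableSpace G] [BorelSpace G] [SecondCountableTopology G] [NeZero L] in
/-- The smallness of Wilson's weights with plaquette-dependent couplings `|β_p| ≤ 1/(4N (8(d-1)+1)² e²)`: the family
`w_p(W) = e^{β_p Re tr ρ(W)}` satisfies `sup_p |w_p - 1| ≤ ε` with `(8(d-1)+1)² e² ε ≤ 1/2` for
`ε = 2N · 1/(4N (8(d-1)+1)² e²)` (plumbing around `abs_exp_mul_re_trace_sub_one_le`). [cite: ItoSeiler2008Further, §2 Thm 2.2 (1)] -/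
theorem wilsonCouplings_kpSmall (ρ : G →* Matrix (Fin N) (Fin N) ℂ) (hρ : Continuous ρ) (β : Plaquette d L → ℝ)
    (hβ : ∀ p, |β p| ≤ 1 / (4 * N * ((((8 * (d - 1) : ℕ) : ℝ) + 1) ^ 2 * Real.exp 2))) :
    (∀ (p : Plaquette d L) (W : G), |Real.exp (β p * ((ρ W).trace).re) - 1| ≤
        2 * N * (1 / (4 * N * ((((8 * (d - 1) : ℕ) : ℝ) + 1) ^ 2 * Real.exp 2)))) ∧
      (((8 * (d - 1) : ℕ) : ℝ) + 1) ^ 2 *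
          (Real.exp 2 * (2 * N * (1 / (4 * N * ((((8 * (d - 1) : ℕ) : ℝ) + 1) ^ 2 * Real.exp 2))))) ≤ 1 / 2 := by
  have hKpos : (0 : ℝ) < (((8 * (d - 1) : ℕ) : ℝ) + 1) ^ 2 := by positivity
  have hEpos : (0 : ℝ) < Real.exp 2 := Real.exp_pos 2
  constructor
  · intro p W
    have hp := (wilsonFamily_kpSmall (d := d) (L := L) ρ hρ (hβ p)).1 p W
    rw [wilsonFamily_apply] at hp
    refine hp.trans ?_
    have hN : (0 : ℝ) ≤ 2 * N := by positivity
    exact mul_le_mul_of_nonneg_left (hβ p) hN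
  · rcases Nat.eq_zero_or_pos N with hN | hN
    · subst hN
      norm_num
    · have hNpos : (0 : ℝ) < N := by exact_mod_cast hN
      have h : (((8 * (d - 1) : ℕ) : ℝ) + 1) ^ 2 *
          (Real.exp 2 * (2 * N * (1 / (4 * N * ((((8 * (d - 1) : ℕ) : ℝ) + 1) ^ 2 * Real.exp 2))))) = 1 / 2 := by
        field_simp
        ring
      exact h.le

/-- **★★ Every twist sector at strong ANISOTROPIC coupling**: for Wilson's action with plaquette-dependent couplings `β_p`,
`|β_p| ≤ 1/(4N (8(d-1)+1)² e²)` for all `p` (e.g. different temporal and spatial couplings), every second-countable compact `G`,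
continuous `ρ : G →* M_N(ℂ)`, `d ≥ 2`, any background insertion `t` and ANY two twists `z₁, z₂ : Twist d G`:
`1 - Z_{β,t·t_{z₂}}/Z_{β,t·t_{z₁}} ≤ 2d² L^{d-2} e^{-L²/2}`, where `Z_{β,s} = ∫ ∏_p e^{β_p Re tr ρ(s_p U_p)} ∏ dU`
(`fieldZ` of the twisted family). [cite: ItoSeiler2008Further, §2 Thm 2.2 (1)] [cite: tHooft1979Flux, §2 eqs. (2.5)–(2.6)]
[cite: Tomboulis2007Confinement, §6.2 eqs. (6.10)–(6.14)] -/
theorem one_sub_fieldZ_couplings_twistInsertion_div_le (hd : 2 ≤ d) (ρ : G →* Matrix (Fin N) (Fin N) ℂ)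
    (hρ : Continuous ρ) (β : Plaquette d L → ℝ)
    (hβ : ∀ p, |β p| ≤ 1 / (4 * N * ((((8 * (d - 1) : ℕ) : ℝ) + 1) ^ 2 * Real.exp 2)))
    (t : Plaquette d L → G) (z₁ z₂ : QuantumLattice.Twist d G) :
    1 - fieldZ d L (twistBy (fun p => t p * twistInsertion z₂ p) (fun p W => Real.exp (β p * ((ρ W).trace).re))) /
        fieldZ d L (twistBy (fun p => t p * twistInsertion z₁ p) (fun p W => Real.exp (β p * ((ρ W).trace).re))) ≤
      2 * (d : ℝ) ^ 2 * (L : ℝ) ^ (d - 2) * Real.exp (-(1 / 2 * (L : ℝ) ^ 2)) := by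
  obtain ⟨hε, hsmall⟩ := wilsonCouplings_kpSmall (d := d) (L := L) ρ hρ β hβ
  exact one_sub_fieldZ_twistInsertion_div_twistInsertion_le hd z₁ z₂ t
    (fun p => measurable_exp_mul_re_trace ρ hρ (β p)) hε hsmall

/-- The logarithmic two-sided form at anisotropic coupling: `|ln Z_{β,t·t_{z₁}} - ln Z_{β,t·t_{z₂}}| ≤ 2 · #plaquettes · e^{-L²}`.
[cite: Tomboulis2007Confinement, §6.2 eqs. (6.10)–(6.12)] [cite: tHooft1979Flux, §2 eqs. (2.5)–(2.6)] -/
theorem abs_log_fieldZ_couplings_twistInsertion_sub_le (ρ : G →* Matrix (Fin N) (Fin N) ℂ) (hρ : Continuous ρ)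
    (β : Plaquette d L → ℝ) (hβ : ∀ p, |β p| ≤ 1 / (4 * N * ((((8 * (d - 1) : ℕ) : ℝ) + 1) ^ 2 * Real.exp 2)))
    (t : Plaquette d L → G) (z₁ z₂ : QuantumLattice.Twist d G) :
    |Real.log (fieldZ d L (twistBy (fun p => t p * twistInsertion z₁ p) (fun p W => Real.exp (β p * ((ρ W).trace).re)))) -
        Real.log (fieldZ d L (twistBy (fun p => t p * twistInsertion z₂ p)
          (fun p W => Real.exp (β p * ((ρ W).trace).re))))| ≤
      2 * (Fintype.card (Plaquette d L) : ℝ) * Real.exp (-((L : ℝ) ^ 2)) := by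
  obtain ⟨hε, hsmall⟩ := wilsonCouplings_kpSmall (d := d) (L := L) ρ hρ β hβ
  exact abs_log_fieldZ_twistInsertion_sub_le z₁ z₂ t (fun p => measurable_exp_mul_re_trace ρ hρ (β p)) hε hsmall

end CentralTwist

end Literature.MathematicalPhysics.QuantumFieldTheory
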